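import Literature.NumberTheory.Automorphic.HeckeLatticeCount
import Mathlib.RingTheory.Polynomial.Vieta
import HarnessLib

/-!
# Tamagawa's identity `∑ (-1)^i q^{i(i-1)/2} t_i X^{n-i} = ∏ (X - q^{(n-1)/2} α_j)` — discharge

Topic `NumberTheory/Automorphic`; proof file discharging the named fact
`Literature.NumberTheory.Automorphic.heckePolynomial_eq_satakePolynomial` of `SatakeParametersGL`
(Tamagawa (1963); Shimura, *Introduction to the arithmetic theory of automorphic functions* (1971),
Thm. 3.21 with (3.2.3)): if `t_i = q^{i(n-i)/2} e_i(α)` for `i ≤ n` and `#α = n`, then the Hecke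
polynomial `∑_{i=0}^{n} (-1)^i q^{i(i-1)/2} t_i X^{n-i}` (`heckePolynomial q n t`, the exponent
`i(i-1)/2` an exact natural number) is the Satake polynomial `∏_{a ∈ α} (X - q^{(n-1)/2} a)`
(`satakePolynomial`). Pure algebra: Vieta's formula
(Mathlib `Multiset.prod_X_sub_X_eq_sum_esymm`), `e_i(c • α) = c^i e_i(α)`
(`Multiset.pow_smul_esymm`) and the exponent bookkeeping `i(i-1) + i(n-i) = (n-1) i`
(`two_mul_choose_two_add_mul_sub` of `HeckeLatticeCount`, which proves the reciprocal form
`heckePolynomial_eq_prod_one_sub` used by Tamagawa's rationality theorem `TamagawaHeckeSeries`).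

## References

* G. Shimura, *Introduction to the arithmetic theory of automorphic functions* (1971), Thm. 3.21,
  (3.2.3) [ShimuraIATAF1971]; T. Tamagawa, Ann. of Math. 77 (1963) [TamagawaAnnals1963].
-/

noncomputable section

open Polynomial

namespace Literature.NumberTheory.Automorphic

/-- **Tamagawa's identity, discharged**: the named fact `heckePolynomial_eq_satakePolynomial`
holds — `∑_{i=0}^{n} (-1)^i q^{i(i-1)/2} t_i X^{n-i} = ∏_{a ∈ α} (X - q^{(n-1)/2} a)` whenever
`t_i = q^{i(n-i)/2} e_i(α)` (`i ≤ n`) and `#α = n` (Shimura (1971), Thm. 3.21; Tamagawa (1963)).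
[cite: ShimuraIATAF1971, Theorem 3.21] -/
theorem heckePolynomial_eq_satakePolynomial_holds : heckePolynomial_eq_satakePolynomial := by
  intro q n t α ht hα
  set c : ℂ := ((Real.sqrt q : ℝ) : ℂ) ^ (n - 1) with hc
  rw [satakePolynomial, heckePolynomial]
  have hprod : ((α.map fun a => c * a).map fun a => X - C a).prod =
      ∑ j ∈ Finset.range (n + 1), (-1) ^ j * (C ((α.map fun a => c * a).esymm j) * X ^ (n - j)) := by
    rw [Multiset.prod_X_sub_X_eq_sum_esymm, Multiset.card_map, hα]
  rw [hprod]
  refine Finset.sum_congr rfl fun i hi => ?_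
  rw [Finset.mem_range, Nat.lt_succ_iff] at hi
  -- `e_i(c • α) = c^i e_i(α)`
  have hes : (α.map fun a => c * a).esymm i = c ^ i * α.esymm i := by
    have := Multiset.pow_smul_esymm c i α
    simp only [smul_eq_mul] at this
    rw [← this]
  -- `q^{i(i-1)/2} (√q)^{i(n-i)} = c^i`
  have hq : (q : ℂ) = ((Real.sqrt q : ℝ) : ℂ) ^ 2 := by
    rw [← Complex.ofReal_pow, Real.sq_sqrt (Nat.cast_nonneg q)]; simp
  have hexp : (q : ℂ) ^ (i * (i - 1) / 2) * ((Real.sqrt q : ℝ) : ℂ) ^ (i * (n - i)) = c ^ i := by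
    rw [hq, ← pow_mul, hc, ← pow_mul, ← pow_add, ← Nat.choose_two_right,
      two_mul_choose_two_add_mul_sub n i hi]
  rw [ht i hi, hes, map_mul, map_mul, map_pow, ← hexp]
  simp only [map_mul, map_pow, map_neg, map_one]
  ring

end Literature.NumberTheory.Automorphic
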